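import Summits.AtomisticToContinuum.BoseEinsteinCondensation.Theorems.BECSubharmonicContinuationCoreContinuationBallGreenIdentity
import Summits.AtomisticToContinuum.BoseEinsteinCondensation.Theorems.BECSubharmonicContinuationCoreContinuationHarmonicMinorantAbstract
import Summits.AtomisticToContinuum.BoseEinsteinCondensation.Theorems.BECSubharmonicContinuationCoreContinuation
import Summits.AtomisticToContinuum.BoseEinsteinCondensation.Theorems.BECSubharmonicContinuationCoreDeficitBounds
import Summits.AtomisticToContinuum.BoseEinsteinCondensation.Theorems.BECSubharmonicContinuationBallCriterion
import HarnessLib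

/-!
# Route `BECSubharmonicContinuation` — `HarmonicMinorant` and the cell-free door `CoreContinuation`
# (stmt-AtomisticToContinuum-14570), closed

* `harmonicMinorant_holds : HarmonicMinorant` — the abstract harmonic minorant
  (`harmonicMinorant_of_hasSum`, `…HarmonicMinorantAbstract.lean`) instantiated with the momentum
  representation of the translation and gradient correlations of a periodic trial state
  (`CoreDeficitBounds.hasSum_G`, `hasSum_H`, `hasSum_coeff`: weights `aₙ = L^{3N}|ĉₙ(Ψ)|²`, wave
  vectors `κₙ = 2πn(i,·)/L`) and the per-mode ball Green identity
  (`norm_sq_mul_integral_ball_cos_mul_ballKernel`, `…BallGreenIdentity.lean`). By type this is the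
  route's support item stmt-AtomisticToContinuum-9003.
* `coreContinuation_proof : CoreContinuation` — the landed glue `coreContinuation_of`
  (`…CoreContinuation.lean`) fed with `harmonicMinorant_holds` and the landed `CoreDeficitBounds_proof`,
  `ballCriterion_proof`: crux `CoreSubharmonicCoherence` alone yields the Target `PeriodicBEC`
  (`n₀ ≥ N/8` for periodic near-minimisers at small density).

## References

* E. H. Lieb, R. Seiringer, J. P. Solovej, J. Yngvason, *The Mathematics of the Bose Gas and its
  Condensation*, Birkhäuser 2005, §1.2 (1.17)–(1.19), Thm. 2.2 (2.14). [LiebSeiringerSolovejYngvason2005]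
* D. Gilbarg, N. S. Trudinger, *Elliptic Partial Differential Equations of Second Order*,
  Springer 2001, §2.4–2.5. [GilbargTrudinger2001]
-/

noncomputable section

open MeasureTheory Set Real Metric
open scoped BigOperators RealInnerProductSpace

namespace Summit.AtomisticToContinuum.BoseEinsteinCondensation.Theorems.CoreContinuationKernel

open Literature.MathematicalPhysics.QuantumManyBody.BoseGas
open Summit.AtomisticToContinuum.BoseEinsteinCondensation.Theorems.CoreDeficitBounds

/-! ### The route statements -/

/-- **`HarmonicMinorant`** (the continuation lemma of route BECSubharmonicContinuation, item
stmt-AtomisticToContinuum-9003, proved here as a helper for `CoreContinuation`): for `L > 0`, every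
periodic trial state `Ψ`, particle `i` and `0 < R ≤ S`,
`1 - ⨍_{B(0,S)} G ≤ (4π)⁻¹∫_{B(0,R)} H/|y| + H(0)R³/S + (4π)⁻¹∫_{R≤|y|≤S} H₊/|y|`
— `harmonicMinorant_of_hasSum` instantiated with the momentum representation of `G` and `H`
(`CoreDeficitBounds.hasSum_G`, `hasSum_H`, `hasSum_coeff`: weights `aₙ = L^{3N}|ĉₙ(Ψ)|²`, wave
vectors `κₙ = 2πn(i,·)/L`) and the per-mode ball Green identity
`norm_sq_mul_integral_ball_cos_mul_ballKernel`. [cite: GilbargTrudinger2001, §2.4–2.5; Bargmann1952] -/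
theorem harmonicMinorant_holds :
    Summit.AtomisticToContinuum.BoseEinsteinCondensation.Theses.BECSubharmonicContinuation.HarmonicMinorant := by
  intro N L hL Ψ i R S hR hRS
  beta_reduce
  set κ : (Fin N × Fin 3 → ℤ) → Space :=
    fun n => WithLp.toLp 2 (fun k : Fin 3 => 2 * Real.pi * (n (i, k) : ℝ) / L) with hκdef
  have hκ : ∀ n k, κ n k = 2 * Real.pi * (n (i, k) : ℝ) / L := fun n k => by
    rw [hκdef, PiLp.toLp_apply]
  exact harmonicMinorant_of_hasSum (a := fun n => (L ^ 3) ^ N * ‖configFourierCoeff L Ψ.ψ n‖ ^ 2)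
    (fun n => by positivity) (hasSum_coeff hL Ψ) κ (hasSum_G hL Ψ hκ) (hasSum_H hL Ψ hκ) hR hRS
    (fun k => norm_sq_mul_integral_ball_cos_mul_ballKernel k (hR.trans_le hRS))

/-- **`CoreContinuation`** (item stmt-AtomisticToContinuum-14570 of route BECSubharmonicContinuation,
the cell-free door): `CoreSubharmonicCoherence → PeriodicBEC` — the landed glue
`coreContinuation_of` fed with `harmonicMinorant_holds`, `CoreDeficitBounds_proof` and
`ballCriterion_proof`. [cite: LSSY2005, Thm. 2.2 (2.14); §1.2 (1.17)–(1.19)] -/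
theorem coreContinuation_proof :
    Summit.AtomisticToContinuum.BoseEinsteinCondensation.Theses.BECSubharmonicContinuation.CoreContinuation :=
  coreContinuation_of harmonicMinorant_holds CoreDeficitBounds_proof ballCriterion_proof

end Summit.AtomisticToContinuum.BoseEinsteinCondensation.Theorems.CoreContinuationKernel

end
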